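import Literature.AlgebraicGeometry.Resolution.AbhyankarEtaleAscentProofs
import Literature.AlgebraicGeometry.Resolution.KnafKuhlmann2005Thm34HenselRoot
import Literature.AlgebraicGeometry.Resolution.AbhyankarRationalUniformization
import Literature.AlgebraicGeometry.Resolution.KnafKuhlmann2009Prop23
import Literature.AlgebraicGeometry.Resolution.ValuedFunctionFieldsLemmas
import Summits.ResolutionOfSingularities.ResolutionOfSingularities.Theorems.ValuativeLuAlphaPTorsorHenselRootChart
import Summits.ResolutionOfSingularities.ResolutionOfSingularities.Theorems.ValuativeLuAlphaPTorsorAdaptedDefs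
import Mathlib.FieldTheory.Minpoly.IsIntegrallyClosed
import Mathlib.RingTheory.Polynomial.UniqueFactorization
import Mathlib.RingTheory.Polynomial.RationalRoot
import Mathlib.RingTheory.Polynomial.ScaleRoots
import HarnessLib

/-!
# Adapted Hensel-root charts: Perron data for the Hensel root

Crux `Valuative.LuAlphaPTorsor` (item `stmt-ResolutionOfSingularities-0641`), line
`pfaff-line-log-final-forms`, registered stub `stub_adaptedHenselRootChart` (F3, reshape v6.3);
registered helper sub-goal `adHensel_derivative_scaleRoots_eval`.

`adHensel_perronData` repackages steps (1)–(3) of S2 (`stub_henselRootChart`,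
`…HenselRootChart`): Knaf–Kuhlmann 2005, Thm. 3.4 in Hensel-root form
(`KnafKuhlmann2005_Thm34_henselRoot_holds`) along `M` gives `M = E(η)`, `E = k(x)` with `x` of
`ℤ`-independent values (no residue-transcendental `y`'s, `O` being zero-dimensional), `η ∈ O` a
root of a monic `f` over `O ∩ E` with `v(f'(η)) = 1`; Perron (Thm. 4.1,
`knafKuhlmann2005_thm41_field`) replaces `x` by `x'` with `k(x') = k(x)`, `v(x'ⱼ) < 1`, and puts
the coefficients of `f` in `k[x'][1/d]`, `v(d) = 1`. NEW here: the scaled root `η₁ = d η` of the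
MONIC `g(T) = d^N f(T/d)` (`Polynomial.scaleRoots`) has coefficients in the POLYNOMIAL ring
`k[x']`, and `g'(η₁) = d^{N-1} f'(η)` (`adHensel_derivative_scaleRoots_eval`) is still a unit.
-/

-- single-problem summit: the doubled namespace component `ResolutionOfSingularities` is forced
set_option linter.dupNamespace false

namespace Summit.ResolutionOfSingularities.ResolutionOfSingularities.Theorems.PfaffLine

open IsLocalRing Polynomial Literature.AlgebraicGeometry.Resolution

/-! ### The derivative of a root-scaled polynomial -/

/-- **Registered anchor.** `(f_d)'(d η) = d^{N-1} f'(η)` for `f_d(Y) = d^N f(Y/d)` (`scaleRoots`), `N = deg f ≥ 1`.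
[folklore] -/
theorem adHensel_derivative_scaleRoots_eval :
    ∀ (K : Type) [Field K] (f : Polynomial K) (d η : K), 0 < f.natDegree → Polynomial.eval (d * η) (Polynomial.derivative (f.scaleRoots d)) = d ^ (f.natDegree - 1) * Polynomial.eval η (Polynomial.derivative f) := by
  intro K _ f d η hf
  have hN : (f.scaleRoots d).natDegree = f.natDegree := natDegree_scaleRoots f d
  have hb1 : (derivative (f.scaleRoots d)).natDegree < f.natDegree := by
    have h := natDegree_derivative_lt (p := f.scaleRoots d) (by rw [hN]; exact hf.ne')
    rwa [hN] at h
  have hb2 : (derivative f).natDegree < f.natDegree := natDegree_derivative_lt hf.ne'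
  rw [eval_eq_sum_range' hb1, eval_eq_sum_range' hb2, Finset.mul_sum]
  refine Finset.sum_congr rfl fun i hi => ?_
  rw [Finset.mem_range] at hi
  rw [coeff_derivative, coeff_derivative, coeff_scaleRoots, mul_pow]
  have e : d ^ (f.natDegree - (i + 1)) * d ^ i = d ^ (f.natDegree - 1) := by
    rw [← pow_add]
    congr 1
    omega
  calc f.coeff (i + 1) * d ^ (f.natDegree - (i + 1)) * ((i : K) + 1) * (d ^ i * η ^ i)
      = f.coeff (i + 1) * ((i : K) + 1) * η ^ i * (d ^ (f.natDegree - (i + 1)) * d ^ i) := by ring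
    _ = d ^ (f.natDegree - 1) * (f.coeff (i + 1) * ((i : K) + 1) * η ^ i) := by rw [e]; ring


/-! ### Perron data for the Hensel root (Knaf–Kuhlmann 2005, Thm. 3.4 and Thm. 4.1) -/

/-- **Perron data.** Along `M` (finitely generated, Abhyankar, residually separably generated,
`K/M` algebraic, `O` zero-dimensional): elements `x'₁, …, x'_ρ ∈ 𝔪_O ∩ M`, non-zero with
`ℤ`-independent values, `η₁ ∈ O ∩ M` and a MONIC `g ∈ K[T]` with coefficients in `k[x']`,
`g(η₁) = 0`, `v(g'(η₁)) = 1`, such that `M ⊆ k(x', η₁)` and `K` is algebraic over `k(x')`.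
(Knaf–Kuhlmann's Hensel root `η` of the monic `f` over `O ∩ k(x)` — `KnafKuhlmann2005_Thm34_henselRoot_holds`;
no residue-transcendental `y`'s as `O` is zero-dimensional; Perron's Thm. 4.1
`knafKuhlmann2005_thm41_field` puts the coefficients of `f` in `k[x'][1/d]`, `v(d) = 1`; then
`η₁ := d η` is a root of the monic `g(T) = d^N f(T/d) ∈ k[x'][T]` with `g'(η₁) = d^{N-1} f'(η)`.)
[cite: KnafKuhlmann2005, Thm. 3.4 and Thm. 4.1] -/
theorem adHensel_perronData {k K : Type} [Field k] [Field K] [Algebra k K]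
    (O : ValuationSubring K) (hk : ∀ c : k, algebraMap k K c ∈ O)
    (hzd : ∀ x : K, x ∈ O → ∃ f : Polynomial k, f ≠ 0 ∧ Polynomial.aeval x f ∈ O.nonunits)
    (M : IntermediateField k K) (hMfg : M.FG)
    (hAbh : IsAbhyankarPlace O (algebraMap k K).fieldRange M.toSubfield)
    (hsep : SeparablyGeneratedOver (resField O (algebraMap k K).fieldRange)
      (resField O M.toSubfield))
    (hKM : ∀ z : K, IsAlgebraic M z) :
    ∃ (ρ : ℕ) (x' : Fin ρ → K) (η₁ : K) (g : K[X]),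
      (∀ j, x' j ≠ 0 ∧ O.valuation (x' j) < 1 ∧ x' j ∈ M.toSubfield) ∧
      (∀ m : Fin ρ → ℤ, (∏ j, O.valuation (x' j) ^ (m j)) = 1 → m = 0) ∧
      η₁ ∈ O ∧ η₁ ∈ M.toSubfield ∧ g.Monic ∧ (∀ i, g.coeff i ∈ Algebra.adjoin k (Set.range x')) ∧
      g.eval η₁ = 0 ∧ O.valuation ((derivative g).eval η₁) = 1 ∧
      ((M : Set K) ⊆ Subfield.closure
        (((algebraMap k K).fieldRange : Set K) ∪ Set.range x' ∪ {η₁})) ∧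
      (∀ z : K, IsAlgebraic
        (Subfield.closure (((algebraMap k K).fieldRange : Set K) ∪ Set.range x')) z) := by
  classical
  -- the ground field `k̄ ⊆ K` and the subfield `F` underlying `M`
  set kK : Subfield K := (algebraMap k K).fieldRange with hkKdef
  set F : Subfield K := M.toSubfield with hFdef
  have hkKO : (kK : Set K) ⊆ O := by
    rintro _ ⟨c, rfl⟩
    exact hk c
  have hkKO' : ∀ c ∈ kK, c ∈ O := fun c hc => hkKO hc
  have hkKF : kK ≤ F := by
    rintro _ ⟨c, rfl⟩
    exact M.algebraMap_mem c
  have hFG : FGOver kK F := by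
    obtain ⟨s, hs⟩ := hMfg
    refine ⟨s, ?_⟩
    have h1 : (IntermediateField.adjoin k (s : Set K)).toSubfield =
        Subfield.closure (Set.range (algebraMap k K) ∪ (s : Set K)) := rfl
    rw [hkKdef, RingHom.coe_fieldRange, ← h1, hs]
  -- Step 1: Knaf–Kuhlmann 2005, Thm. 3.4 in Hensel-root form, along `F`
  obtain ⟨ρ, τ, x, y, hy, hxF, -, hxi, hri, η, hηO, f, hgen, hfmon, hcoef, hfη, hfder⟩ :=
    KnafKuhlmann2005_Thm34_henselRoot_holds K O kK F hkKF hFG hkKO hAbh hsep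
  letI : Algebra k O := algebraOfMem k O hk
  haveI : IsScalarTower k O K := isScalarTower_algebraOfMem k O hk
  -- Step 2: `O` is zero-dimensional, so there are no `y`'s
  have hτ : τ = 0 := by
    have hyk : AlgebraicIndependent k fun j => residue O ⟨y j, hy j⟩ := by
      obtain ⟨φ, -, -, hφ, -⟩ := exists_residue_ringHoms O kK (F := kK) le_rfl hkKO'
      let φ' : k →+* resField O kK := φ.comp (algebraMap k K).rangeRestrictField
      refine AlgebraicIndependent.of_ringHom_of_comp_eq φ' (RingHom.id (ResidueField O))
        (by simpa using hri) φ'.injective ?_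
      ext c
      change ((φ ((algebraMap k K).rangeRestrictField c) : ResidueField O)) =
        residue O ⟨algebraMap k K c, hk c⟩
      rw [hφ]
      rfl
    refine (Nat.eq_zero_or_pos τ).resolve_right fun h => ?_
    obtain ⟨g, hg0, hg⟩ := hzd (y ⟨0, h⟩) (hy ⟨0, h⟩)
    rw [ValuationSubring.mem_nonunits_iff, valuation_aeval_lt_one_iff O hk (hy ⟨0, h⟩)] at hg
    exact hyk.transcendental ⟨0, h⟩ ⟨g, hg0, hg⟩
  subst hτ
  -- the rational function field `E = k̄(x)` with `F = E(η)`
  set E : Subfield K := Subfield.closure ((kK : Set K) ∪ (Set.range x ∪ Set.range y)) with hEdef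
  have hEF : E ≤ F := le_trans (fun z hz => Subfield.subset_closure (Or.inl hz)) hgen.le
  have hηF : η ∈ F := hgen.le (Subfield.subset_closure (Or.inr rfl))
  -- Step 3: Perron (Knaf–Kuhlmann 2005, Thm. 4.1) on the coefficients of `f`
  have hx0 : ∀ i, x i ≠ 0 := fun i => (hxF i).2
  set Z : Finset K := (Finset.range (f.natDegree + 1)).image f.coeff with hZdef
  have hZ : ∀ z ∈ Z, z ∈ O ∧ z ∈ E := by
    intro z hz
    obtain ⟨i, -, rfl⟩ := Finset.mem_image.mp hz
    exact hcoef i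
  obtain ⟨x', hx'E, hxE', hxi', -, hZrep⟩ :=
    knafKuhlmann2005_thm41_field O kK hkKO' x y hx0 hxi hy hri Z hZ
  have hx'0 : ∀ j, x' j ≠ 0 := fun j => (hx'E j).2.1
  have hvx' : ∀ j, O.valuation (x' j) < 1 := fun j => (hx'E j).2.2
  set A : Subalgebra kK K := Algebra.adjoin kK (Set.range x' ∪ Set.range y) with hAdef
  have hAE : ∀ z ∈ A, z ∈ E :=
    adjoin_le_of_mem E (fun c => Subfield.subset_closure (Or.inl c.2)) (by
      rintro _ (⟨j, rfl⟩ | ⟨j, rfl⟩)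
      · exact (hx'E j).1
      · exact Subfield.subset_closure (Or.inr (Or.inr ⟨j, rfl⟩)))
  set A' : Subalgebra k K := Algebra.adjoin k (Set.range x') with hA'def
  have hAA' : ∀ z ∈ A, z ∈ A' :=
    adjoin_le_of_mem A' (fun c => by
      obtain ⟨c', hc'⟩ := c.2
      rw [show algebraMap kK K c = (c : K) from rfl, ← hc']
      exact A'.algebraMap_mem c') (by
      rintro _ (⟨j, rfl⟩ | ⟨j, -⟩)
      · exact Algebra.subset_adjoin ⟨j, rfl⟩
      · exact j.elim0)
  -- the common denominator `d` of the coefficients of `f`, `v(d) = 1`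
  choose num hnum den hden hvden hzeq using hZrep
  set d : K := ∏ w ∈ Z.attach, den w w.2 with hddef
  have hdA : d ∈ A := prod_mem fun w _ => hden w w.2
  have hvd : O.valuation d = 1 := by
    rw [hddef, map_prod]
    exact Finset.prod_eq_one fun w _ => hvden w w.2
  have hd0 : d ≠ 0 := fun h0 => by
    rw [h0, map_zero] at hvd
    exact zero_ne_one hvd
  have hdO : d ∈ O := (O.valuation_le_one_iff _).mp hvd.le
  have hZdA : ∀ z ∈ Z, z * d ∈ A := by
    intro z hz
    have hden0 : den z hz ≠ 0 := fun h0 => by simpa [h0] using hvden z hz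
    have hsplit : d = den z hz * ∏ w ∈ Z.attach.erase ⟨z, hz⟩, den w w.2 :=
      (Finset.mul_prod_erase Z.attach (fun w : {w // w ∈ Z} => den w w.2)
        (Finset.mem_attach _ ⟨z, hz⟩)).symm
    have hzden : z * den z hz = num z hz := (eq_div_iff hden0).mp (hzeq z hz)
    rw [hsplit, ← mul_assoc, hzden]
    exact mul_mem (hnum z hz) (prod_mem fun w _ => hden w w.2)
  -- Step 4: the scaled root `η₁ = d η` of the monic `g(T) = d^N f(T/d)` over `k[x']`
  have hN0 : 0 < f.natDegree := by
    by_contra h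
    rw [not_lt, Nat.le_zero] at h
    rw [eq_one_of_monic_natDegree_zero hfmon h, eval_one] at hfη
    exact one_ne_zero hfη
  have hgcoef : ∀ i, (f.scaleRoots d).coeff i ∈ A' := by
    intro i
    rw [coeff_scaleRoots]
    rcases lt_trichotomy i f.natDegree with hi | hi | hi
    · have hzZ : f.coeff i ∈ Z :=
        Finset.mem_image.mpr ⟨i, Finset.mem_range.mpr (by omega), rfl⟩
      have e : f.coeff i * d ^ (f.natDegree - i) = f.coeff i * d * d ^ (f.natDegree - i - 1) := by
        rw [mul_assoc, ← pow_succ']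
        congr 2
        omega
      rw [e]
      exact hAA' _ (mul_mem (hZdA _ hzZ) (pow_mem hdA _))
    · rw [hi, hfmon.coeff_natDegree, one_mul, Nat.sub_self, pow_zero]
      exact one_mem _
    · rw [coeff_eq_zero_of_natDegree_lt hi, zero_mul]
      exact zero_mem _
  have hη₁O : d * η ∈ O := mul_mem hdO hηO
  have hdE : d ∈ E := hAE d hdA
  have hη₁F : d * η ∈ F := mul_mem (hEF hdE) hηF
  have hgmon : (f.scaleRoots d).Monic := (monic_scaleRoots_iff d).mpr hfmon
  have hgη : (f.scaleRoots d).eval (d * η) = 0 := by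
    rw [scaleRoots_eval_mul, hfη, mul_zero]
  have hgder : O.valuation ((derivative (f.scaleRoots d)).eval (d * η)) = 1 := by
    rw [adHensel_derivative_scaleRoots_eval K f d η hN0, map_mul, map_pow, hvd, one_pow, one_mul,
      hfder]
  -- Step 5: `M ⊆ k(x', η₁)`
  have hE' : E ≤ Subfield.closure ((kK : Set K) ∪ Set.range x') := by
    rw [hEdef, Subfield.closure_le]
    refine Set.union_subset (fun z hz => Subfield.subset_closure (Or.inl hz))
      (Set.union_subset ?_ ?_)
    · rintro _ ⟨i, rfl⟩
      exact hxE' i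
    · rintro _ ⟨j, -⟩
      exact j.elim0
  have hcl : E ≤ Subfield.closure ((kK : Set K) ∪ Set.range x' ∪ {d * η}) :=
    hE'.trans (Subfield.closure_mono Set.subset_union_left)
  have hAcl : ∀ z ∈ A, z ∈ Subfield.closure ((kK : Set K) ∪ Set.range x' ∪ {d * η}) :=
    fun z hz => hcl (hAE z hz)
  have hηcl : η ∈ Subfield.closure ((kK : Set K) ∪ Set.range x' ∪ {d * η}) := by
    have h : d⁻¹ * (d * η) ∈ Subfield.closure ((kK : Set K) ∪ Set.range x' ∪ {d * η}) :=
      mul_mem (inv_mem (hAcl d hdA)) (Subfield.subset_closure (Or.inr rfl))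
    rwa [← mul_assoc, inv_mul_cancel₀ hd0, one_mul] at h
  have hMcl : (M : Set K) ⊆ Subfield.closure ((kK : Set K) ∪ Set.range x' ∪ {d * η}) := by
    intro z hz
    refine (Subfield.closure_le.mpr (Set.union_subset (fun w hw => hcl hw) ?_))
      (hgen.ge (show z ∈ F from hz))
    exact Set.singleton_subset_iff.mpr hηcl
  -- Step 6: `K` is algebraic over `k̄(x')`
  have hηalg : IsAlgebraic E η := by
    have hl : f ∈ Polynomial.lifts (algebraMap E K) :=
      (Polynomial.lifts_iff_coeff_lifts f).mpr fun i => ⟨⟨f.coeff i, (hcoef i).2⟩, rfl⟩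
    obtain ⟨fE, hfE, -, hfEmon⟩ := Polynomial.lifts_and_degree_eq_and_monic hl hfmon
    refine ⟨fE, hfEmon.ne_zero, ?_⟩
    rw [aeval_def, ← eval_map, hfE, hfη]
  have hFalg : ∀ z ∈ F, IsAlgebraic E z := by
    intro z hz
    refine isAlgebraic_of_mem_closure (K := E) (s := {η}) (fun a ha => ?_) (hgen.ge hz)
    rw [Set.mem_singleton_iff] at ha
    rw [ha]
    exact hηalg
  have hKalg : ∀ z : K, IsAlgebraic (Subfield.closure ((kK : Set K) ∪ Set.range x')) z := by
    intro z
    have h1 : IsAlgebraic F z :=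
      isAlgebraic_of_ringHom_comp_eq (F₁ := M) (F₂ := F)
        { toFun := fun m => ⟨m.1, m.2⟩
          map_one' := rfl
          map_mul' := fun _ _ => rfl
          map_zero' := rfl
          map_add' := fun _ _ => rfl } (RingHom.ext fun _ => rfl) (hKM z)
    exact isAlgebraic_of_subfield_le hE' (isAlgebraic_trans_subfield hEF hFalg h1)
  have hvalind : ∀ m : Fin ρ → ℤ, (∏ i, O.valuation (x' i) ^ (m i)) = 1 → m = 0 :=
    fun m hm => hxi' m ⟨1, kK.one_mem, by rw [hm, map_one]⟩
  exact ⟨ρ, x', d * η, f.scaleRoots d, fun j => ⟨hx'0 j, hvx' j, hEF (hx'E j).1⟩, hvalind, hη₁O,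
    hη₁F, hgmon, hgcoef, hgη, hgder, hMcl, hKalg⟩

end Summit.ResolutionOfSingularities.ResolutionOfSingularities.Theorems.PfaffLine
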